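import Summits.PneNP.PneNP.Theses.ExpanderLinearGenerators
import Summits.PneNP.PneNP.Theorems.ExpanderLinearGeneratorsLinearGeneratorModPFregeHardMod2Vacuous
import Summits.PneNP.PneNP.Theorems.ExpanderLinearGeneratorsLinearGeneratorModPFregeHardCalibration
import Summits.PneNP.PneNP.Theorems.ExpanderLinearGeneratorsLinearGeneratorDepthFregeHardNonvacuous
import HarnessLib

/-!
# `LinearGeneratorModPFregeHard`: the `p = 2` variant is false, and the odd-`p` rung is
exercised by explicit instances (item stmt-PneNP-11444)

Support file for item `stmt-PneNP-11444`
(`Summit.PneNP.PneNP.Theses.ExpanderLinearGenerators.LinearGeneratorModPFregeHard`, the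
`AC⁰[p]`-Frege rung of route `ExpanderLinearGenerators`, stated for primes `p ≠ 2`).  Two facts
about the shape of the item, both obtained by feeding the explicit family of
`…LinearGeneratorDepthFregeHardNonvacuous.lean` (Tseitin systems of Margulis's large-girth Cayley
graphs of `SL₂(ℤ/N)`: `16`-sparse, `(n^(1-δ), 12)`-boundary expanding for `δ ≥ 199/200`,
unsolvable, on `n` variables for EVERY `n ≥ 2¹¹·800⁸`) into the calibration files of the item:

* `not_linearGeneratorModTwoFregeHard` — **the hypothesis `p ≠ 2` cannot be dropped**: the
  statement of the rung with `p = 2` is FALSE outright (not merely "vacuous where true"):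
  `…Mod2Vacuous.lean` shows that the `p = 2` statement forces every large expanding sparse
  system to be solvable, and the explicit family supplies unsolvable ones of every large size.
  Hence also `not_linearGeneratorModPFregeHard_all_primes` (the rung over all primes fails).
* `linearGeneratorModPFregeHard_hypotheses_nonvacuous` — for EVERY modulus `p`, every
  `n ≥ N₀` and every `δ ≥ 199/200` there is a system meeting all hypotheses of the rung at
  `ℓ = 16`, and its target `ofPropForm (¬ ofCNF (sumEncoding 1 E))` HAS depth-`d`
  `textbookFrege(MOD_p)` proofs for every `d ≥ 30`; so under the rung
  (`linearGeneratorModPFregeHard_witnessed`) the bound `2^(n^ε)` is met by actual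
  `F_d(MOD_p)`-proofs of explicit Tseitin formulas for every odd prime `p`, `d ≥ 30`,
  `δ ∈ [199/200, 1)` — on that slice the item is precisely an instance of Krajíček's open
  Problem 15.6.1 (no superpolynomial `F_d(MOD_p)` lower bound is known for any family).

No definitions are introduced.

References: S. Buss, R. Impagliazzo, J. Krajíček, P. Pudlák, A. A. Razborov, J. Sgall,
Comput. Complexity 6 (1996/97), Def. 1.1 [BussImpagliazzoKrajicekPudlakRazborovSgall1997];
J. Krajíček, *Proof Complexity* (CUP 2019), §15.6, Problem 15.6.1 [KrajicekProofComplexity2019];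
G. A. Margulis, Combinatorica 2 (1982) 71–78 [Margulis1982].
-/

set_option linter.dupNamespace false -- `Summit.PneNP.PneNP.…`: summit = sub-problem (D-0017)

namespace Summit.PneNP.PneNP.Theorems

open Literature.Computability.Complexity Literature.Computability.MetaComplexity
open Summit.PneNP.PneNP.Theses.ExpanderLinearGenerators

/-! ### The `p = 2` variant is false -/

/-- **The `p = 2` variant of `LinearGeneratorModPFregeHard` is false.** The body of the rung at
`p = 2` (for all `ℓ ≥ 1`, `d`, `0 < δ < 1` there are `ε > 0`, `N` beyond which every depth-`d`
`textbookFrege(MOD₂)`-proof of `¬ ofCNF (sumEncoding 1 E)` for an `ℓ`-sparse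
`(n^(1-δ), 3ℓ/4)`-boundary-expanding unsolvable `E` has size `≥ 2^(n^ε)`) fails: at `ℓ = 16`,
`δ = 199/200` it would make every large `16`-sparse `(n^(1/200), 12)`-expanding system solvable
(`ModTwo.solvable_of_linearGeneratorModTwoFregeHard`: `MOD₂` gates sum the rows in polynomial
size at depth `35`), contradicting the explicit unsolvable Margulis–Tseitin systems
(`FreeCayley.exists_expanding_unsat_system`). [cite: KrajicekProofComplexity2019, §15.6]
[cite: Margulis1982, main construction] -/
theorem not_linearGeneratorModTwoFregeHard :
    ¬ (∀ (ℓ d : ℕ) (δ : ℝ), 1 ≤ ℓ → 0 < δ → δ < 1 → ∃ ε : ℝ, 0 < ε ∧ ∃ N : ℕ, ∀ n : ℕ, N ≤ n →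
      ∀ (m : ℕ) (E : Fin m → LinEqMod 2 n), (∀ i, (E i).supp.card ≤ ℓ) →
      IsBoundaryExpander (fun i => (E i).supp.map Fin.valEmbedding) ((n : ℝ) ^ (1 - δ))
        (3 / 4 * ℓ) →
      ¬ SystemSat E Finset.univ →
      ∀ π : List (PropFormMod 2 ℕ), textbookFrege.IsModDepthProofOf d π
        (PropFormMod.ofPropForm (PropForm.neg (PropForm.ofCNF (sumEncoding 1 E)))) →
        (2 : ℝ) ^ ((n : ℝ) ^ ε) ≤ (modProofSize π : ℝ)) := by
  intro H
  obtain ⟨N, hN⟩ := ModTwo.solvable_of_linearGeneratorModTwoFregeHard H 16 (199 / 200)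
    (by norm_num) (by norm_num) (by norm_num)
  obtain ⟨m, E, hsp, hexp, hunsat⟩ :=
    FreeCayley.exists_expanding_unsat_system (n := max N (2 ^ 11 * 800 ^ 8)) (le_max_right _ _)
  exact hunsat (hN _ (le_max_left _ _) m E hsp hexp)

/-- **The rung over ALL primes fails**: dropping `p ≠ 2` from `LinearGeneratorModPFregeHard`
gives a false statement (instantiate `p = 2`). [cite: KrajicekProofComplexity2019, §15.6] -/
theorem not_linearGeneratorModPFregeHard_all_primes :
    ¬ (∀ (p : ℕ), p.Prime → ∀ (ℓ d : ℕ) (δ : ℝ), 1 ≤ ℓ → 0 < δ → δ < 1 → ∃ ε : ℝ, 0 < ε ∧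
      ∃ N : ℕ, ∀ n : ℕ, N ≤ n → ∀ (m : ℕ) (E : Fin m → LinEqMod 2 n),
      (∀ i, (E i).supp.card ≤ ℓ) →
      IsBoundaryExpander (fun i => (E i).supp.map Fin.valEmbedding) ((n : ℝ) ^ (1 - δ))
        (3 / 4 * ℓ) →
      ¬ SystemSat E Finset.univ →
      ∀ π : List (PropFormMod p ℕ), textbookFrege.IsModDepthProofOf d π
        (PropFormMod.ofPropForm (PropForm.neg (PropForm.ofCNF (sumEncoding 1 E)))) →
        (2 : ℝ) ^ ((n : ℝ) ^ ε) ≤ (modProofSize π : ℝ)) :=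
  fun H => not_linearGeneratorModTwoFregeHard (H 2 Nat.prime_two)

/-! ### The odd-`p` rung is about existing proofs of explicit formulas -/

/-- **The hypotheses of `LinearGeneratorModPFregeHard` are met by explicit instances, for every
modulus.** For every `p`, every `n ≥ N₀` and every `δ ≥ 199/200` there is a `16`-sparse system
`E` over `𝔽₂` on `n` variables whose supports form an `(n^(1-δ), 3/4·16)`-boundary expander and
which is unsolvable, and whose target `ofPropForm (¬ ofCNF (sumEncoding 1 E))` has a depth-`d`
`textbookFrege(MOD_p)` proof for every `d ≥ 30` (the brute-force refutation of
`…ModPFregeHardCalibration.lean`, read in the extended language). [cite: Margulis1982, main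
construction] [cite: KrajicekProofComplexity2019, Problem 15.6.1] -/
theorem linearGeneratorModPFregeHard_hypotheses_nonvacuous (p : ℕ) :
    ∃ N₀ : ℕ, ∀ n : ℕ, N₀ ≤ n → ∀ δ : ℝ, 199 / 200 ≤ δ →
      ∃ (m : ℕ) (E : Fin m → LinEqMod 2 n), (∀ i, (E i).supp.card ≤ 16) ∧
        IsBoundaryExpander (fun i => (E i).supp.map Fin.valEmbedding) ((n : ℝ) ^ (1 - δ))
          (3 / 4 * ((16 : ℕ) : ℝ)) ∧
        ¬ SystemSat E Finset.univ ∧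
        ∀ d : ℕ, 30 ≤ d → ∃ π : List (PropFormMod p ℕ),
          textbookFrege.IsModDepthProofOf d π
            (PropFormMod.ofPropForm (PropForm.neg (PropForm.ofCNF (sumEncoding 1 E)))) := by
  obtain ⟨N₀, hN₀⟩ := linearGeneratorDepthFregeHard_hypotheses_nonvacuous
  refine ⟨N₀, fun n hn δ hδ => ?_⟩
  obtain ⟨m, E, hsp, hexp, hunsat, -⟩ := hN₀ n hn δ hδ
  exact ⟨m, E, hsp, hexp, hunsat, fun d hd => exists_isModDepthProofOf_sumEncoding p E hunsat hd⟩

/-- **Under the rung, the bound is attained by existing `F_d(MOD_p)` proofs.** If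
`LinearGeneratorModPFregeHard` holds then for every odd prime `p`, every depth `d ≥ 30` and every
`δ ∈ [199/200, 1)` there are `ε > 0` and `N` such that for every `n ≥ N` some `16`-sparse
`(n^(1-δ), 12)`-expanding unsolvable system on `n` variables has a depth-`d`
`textbookFrege(MOD_p)` refutation, and every such refutation — in particular that one — has
`modProofSize ≥ 2^(n^ε)`: on this slice the item is a superpolynomial lower bound for
`F_d(MOD_p)` on explicit Tseitin formulas, an instance of Krajíček's Problem 15.6.1 (open for
every family of tautologies). [cite: KrajicekProofComplexity2019, Problem 15.6.1] -/
theorem linearGeneratorModPFregeHard_witnessed (h : LinearGeneratorModPFregeHard) :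
    ∀ (p : ℕ), p.Prime → p ≠ 2 → ∀ (d : ℕ) (δ : ℝ), 30 ≤ d → 199 / 200 ≤ δ → δ < 1 →
      ∃ ε : ℝ, 0 < ε ∧ ∃ N : ℕ, ∀ n : ℕ, N ≤ n →
        ∃ (m : ℕ) (E : Fin m → LinEqMod 2 n) (π : List (PropFormMod p ℕ)),
          (∀ i, (E i).supp.card ≤ 16) ∧
          IsBoundaryExpander (fun i => (E i).supp.map Fin.valEmbedding) ((n : ℝ) ^ (1 - δ))
            (3 / 4 * ((16 : ℕ) : ℝ)) ∧
          ¬ SystemSat E Finset.univ ∧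
          textbookFrege.IsModDepthProofOf d π
            (PropFormMod.ofPropForm (PropForm.neg (PropForm.ofCNF (sumEncoding 1 E)))) ∧
          (2 : ℝ) ^ ((n : ℝ) ^ ε) ≤ (modProofSize π : ℝ) := by
  intro p hp hp2 d δ hd hδ hδ1
  obtain ⟨ε, hε, N, hN⟩ := h p hp hp2 16 d δ (by norm_num) (by linarith) hδ1
  obtain ⟨N₀, hN₀⟩ := linearGeneratorModPFregeHard_hypotheses_nonvacuous p
  refine ⟨ε, hε, max N N₀, fun n hn => ?_⟩
  obtain ⟨m, E, hsp, hexp, hunsat, hprf⟩ := hN₀ n (le_of_max_le_right hn) δ hδ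
  obtain ⟨π, hπ⟩ := hprf d hd
  exact ⟨m, E, π, hsp, hexp, hunsat, hπ, hN n (le_of_max_le_left hn) m E hsp hexp hunsat π hπ⟩

/-- **Summary: the modulus matters.** The same explicit instances separate the two cases of the
item's docstring: with `MOD₂` gates they have depth-`35` refutations of size polynomial in `n`
(so the `p = 2` statement is false, `not_linearGeneratorModTwoFregeHard`), while for odd `p`
the rung asserts that all their depth-`d` `F(MOD_p)`-refutations (which exist from `d = 30` on)
are of size `2^(n^ε)`. Recorded as the conjunction of the two facts.
[cite: KrajicekProofComplexity2019, §15.6] -/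
theorem linearGeneratorModPFregeHard_modulus_dichotomy :
    (¬ ∀ (ℓ d : ℕ) (δ : ℝ), 1 ≤ ℓ → 0 < δ → δ < 1 → ∃ ε : ℝ, 0 < ε ∧ ∃ N : ℕ, ∀ n : ℕ, N ≤ n →
      ∀ (m : ℕ) (E : Fin m → LinEqMod 2 n), (∀ i, (E i).supp.card ≤ ℓ) →
      IsBoundaryExpander (fun i => (E i).supp.map Fin.valEmbedding) ((n : ℝ) ^ (1 - δ))
        (3 / 4 * ℓ) →
      ¬ SystemSat E Finset.univ →
      ∀ π : List (PropFormMod 2 ℕ), textbookFrege.IsModDepthProofOf d π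
        (PropFormMod.ofPropForm (PropForm.neg (PropForm.ofCNF (sumEncoding 1 E)))) →
        (2 : ℝ) ^ ((n : ℝ) ^ ε) ≤ (modProofSize π : ℝ)) ∧
    ∀ p : ℕ, ∃ N₀ : ℕ, ∀ n : ℕ, N₀ ≤ n →
      ∃ (m : ℕ) (E : Fin m → LinEqMod 2 n), (∀ i, (E i).supp.card ≤ 16) ∧
        IsBoundaryExpander (fun i => (E i).supp.map Fin.valEmbedding)
          ((n : ℝ) ^ (1 - (199 / 200 : ℝ))) (3 / 4 * ((16 : ℕ) : ℝ)) ∧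
        ¬ SystemSat E Finset.univ ∧
        ∃ π : List (PropFormMod p ℕ), textbookFrege.IsModDepthProofOf 30 π
          (PropFormMod.ofPropForm (PropForm.neg (PropForm.ofCNF (sumEncoding 1 E)))) := by
  refine ⟨not_linearGeneratorModTwoFregeHard, fun p => ?_⟩
  obtain ⟨N₀, hN₀⟩ := linearGeneratorModPFregeHard_hypotheses_nonvacuous p
  refine ⟨N₀, fun n hn => ?_⟩
  obtain ⟨m, E, hsp, hexp, hunsat, hprf⟩ := hN₀ n hn (199 / 200) le_rfl
  exact ⟨m, E, hsp, hexp, hunsat, hprf 30 le_rfl⟩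

end Summit.PneNP.PneNP.Theorems
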